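import Summits.QuantumFields.YangMills.Theorems.BalabanUVNodesN07PointFeasibilityOneLevelForms
import HarnessLib

/-!
# DAG node N07 [B11], road R0′ — ONE-LEVEL MARGIN, symbol bridge: the MATCHED symbol `Xs(p′) = Σ_l |u(p′+l)|²∕Δ(p′+l)²` and the CENTRE symbol
# `K_{c₀}(p′) = Σ_l e^{i(p′+l)·ηc₀} conj u(p′+l)∕Δ(p′+l)²` as REAL alias sums over the support of `p′` with angles in `(0,2π)`, and
# «display margin ⇒ symbol margin»

Cell `pub-ymgap` (HUMAN RULINGS D-0062 ∕ D-0149 ∕ D-0154), width seat `pub-ymgap-dag-n07-w5` g2, 2026-08-28.  `--kind proof --supports <K1 key> --as helper`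
(count-neutral; CLAIM-2 cell bus).  Sequel of `…N07PointFeasibilityOneLevelForms` (p625080: the transfer «symbol margin ⇒ form margin» on the torus):
this file turns a margin stated for the bare trigonometric alias sums (the shape dag-n07-w7 proves; numerically true with constant `1`) into the
hypothesis `hK` of that transfer.  Pure bookkeeping BY NAME over g0′'s `…OneLevelSymbol` (`factor_eq_real`, `summand_eq_real`, `sum_collapse`,
`sum_reindex`, `signed_alias_sum_pos`) and b05's `B5Momentum133.Xs`; nothing new is asserted about the sums themselves.

THE PRINT.  [B5] = T. Bałaban, *Propagators and renormalization transformations for lattice gauge theories. I*, Commun. Math. Phys. **95** (1984) 17–40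
`[Balaban1984PropagatorsI]`: (1.29)–(1.33) p. 23 (`p = p′ + l`, `u_k(p) = Π_μ ∂¹_μ(p′)∕∂_μ(p)`, «Σ_l |u_k(p′+l)|²∕Δ²(p′+l)»), (1.61) p. 28 (`v_μ`);
[I] = CMP **109** (1987) 249–301 `[Balaban1987RG1]`, (0.4) p. 253 (centres of blocks, odd `L`).

WHAT THIS FILE DOES (`n = 2c₀+1` odd, B5's lattice constant `c = n`, `q ≠ 0` a coarse momentum, `J = {ν | q_ν ≠ 0}`, `θ_κ ∈ (0,2π)` the representative of
`p′_κ`, `f(θ,m) := sin((θ+2πm)∕2)∕(n·sin((θ+2πm)∕(2n)))`, `S(θ,m) := Sxir n (θ+2πm) = 4n²sin²((θ+2πm)∕(2n))`):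
* §8 `norm_om`, ★ `norm_sq_vSym_eq_factor_sq` (`|v_ν(p′+l)|²` is the SQUARE of g0′'s real centred factor — `|ω_ν| = 1`), `Xs_re_eq_realSum`,
  ★ `sum_reindex_gen` (g0′'s signed-representative re-indexing for any `2πn`-periodic numerator∕denominator data), `theta_mem_Ioo`,
  ★★ `matchedSymbol_re_eq_display` (`Re Xs(p′) = Σ_{m∈[0,n)^J} (Π_κ f(θ_κ,m_κ)²)∕(Σ_κ S(θ_κ,m_κ))²`),
  ★★ `centreSymbol_re_eq_display` (`Re K_{c₀}(p′) = Σ_m (Π_κ f(θ_κ,m_κ))∕(Σ_κ S(θ_κ,m_κ))²`, the equation behind g0′'s `centreSymbol_ne_zero`);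
* §9 ★★★ `symbolMargin_of_display`: a PER-COORDINATE domination constant `c₁ ∈ [0,1]` for the bare sums, «`c₁^{|J|}·Σ_m (Π f²)∕(ΣS)² ≤
  Σ_m (Π f)∕(ΣS)²` for every finite non-empty `J` and every `θ ∈ (0,2π)^J`», gives `∀ p′ ≠ 0, c₁^d·Re Xs(p′) ≤ Re K_{c₀}(p′)` — the hypothesis `hK`
  of `…OneLevelForms.matchedForm_le_centreForm_of_symbol`;
  `displayMargin_zero` (the display margin at `cst = 0` = g0′'s `signed_alias_sum_pos`, so the hypothesis is inhabited), ★★★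
  `norm_sq_lapInv_le_centreForm_of_display` (∘ p625080's transfer: display margin ⇒ `c₁^d·‖Δ⁻¹Q′ᴴβ‖² ≤ Re (centre form)` for every `β`).

HONEST FRAMING (binding).  Count-neutral helper; finite trigonometric bookkeeping at ONE averaging level; the display margin with `cst > 0` is NOT proved
here (dag-n07-w7 g4's `…N07AliasSumMargin` announces `(2L)^{−|J|}`; numerically `cst = 1`, see `LOCATED-SHARP-CENTRE-DOMINANCE.md`); asserts NOTHING of
[B11]∕[B6]∕[3]; `(P)_D` ∕ (L2)–(L4) OPEN; nothing consumed under road (a); `hker` ∕ stub 1 ∕ K0⁷ ∕ K1⁹ NOT closed; N07 NOT discharged; counts unmoved; no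
summit statement is proved by this seat — R4 closes the conditional finite-𝕋⁴ rung `BalabanLadder.UV` only; nothing continuum ∕ ℝ⁴ ∕ OS ∕ mass gap ∕
Clay.  No `sorry`, no `def`, no `instance`, no `notation`.
-/

noncomputable section

open scoped BigOperators Matrix ComplexConjugate
open Finset Complex

namespace Summit.QuantumFields.YangMills.BalabanUVNodes.N07PointFeasibilityOneLevel

open Literature.MathematicalPhysics.QuantumFieldTheory.Balaban1983to89
open B5Prop11Plancherel (Tor chi fine sOf abs_sOf_le)
open B5Block118 (pOf iota om bpt QsOp)
open B5Prop11Fiber (vSym uSym)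
open B5LaplaceInverse (lsym LapSinv)
open B5Momentum133 (Xs lsym_pOf)

/-! ## §8  The two symbols as real alias sums over the support of `p′` -/

section Display

variable {d : ℕ} (n : ℕ) [NeZero n] (M : Fin d → ℕ) [hM : ∀ μ, NeZero (M μ)]

omit [NeZero n] hM in
/-- `|ω_ν| = 1`. [folklore] -/
theorem norm_om (k : Fin d → Fin n) (s : Fin d → ℝ) (ν : Fin d) : ‖om n k s ν‖ = 1 :=
  Complex.norm_exp_ofReal_mul_I _

/-- ★ `|v_ν(p′+l)|²` is the SQUARE of the real centred aliasing factor of g0′'s `factor_eq_real` (the phase `ω_ν^{c₀}` has modulus one).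
[cite: Balaban1984PropagatorsI, (1.31) p.23, (1.61) p.28] -/
theorem norm_sq_vSym_eq_factor_sq (c₀ : ℕ) (hc₀ : 2 * c₀ + 1 = n) (k : Fin d → Fin n) (q : Tor M) (ν : Fin d) :
    ‖vSym n k (sOf M q) ν‖ ^ 2
      = (if q ν = 0 then (if k ν = 0 then (1 : ℝ) else 0) else
          Real.sin (B4Strip.shiftr n k (sOf M q) ν / 2) /
            ((n : ℝ) * Real.sin (B4Strip.shiftr n k (sOf M q) ν / (2 * n)))) ^ 2 := by
  have h := congrArg (fun z : ℂ => ‖z‖ ^ 2) (factor_eq_real n M c₀ hc₀ k q ν)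
  simp only [norm_mul, norm_pow, norm_om, one_pow, one_mul, Complex.norm_conj, Complex.norm_real,
    Real.norm_eq_abs, sq_abs] at h
  exact h

/-- `Re Xs(p′)` as a real alias sum over ALL offsets `l ∈ [0,n)^d` with the squared real factors (B5's lattice constant `c = n`).
[cite: Balaban1984PropagatorsI, (1.33) p.23] -/
theorem Xs_re_eq_realSum (c₀ : ℕ) (hc₀ : 2 * c₀ + 1 = n) (q : Tor M) :
    (Xs n M (n : ℂ) q).re
      = ∑ k : Fin d → Fin n, (∏ ν, (if q ν = 0 then (if k ν = 0 then (1 : ℝ) else 0) else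
          Real.sin (B4Strip.shiftr n k (sOf M q) ν / 2) /
            ((n : ℝ) * Real.sin (B4Strip.shiftr n k (sOf M q) ν / (2 * n)))) ^ 2) /
          (∑ ν, B4Strip.Sxir n (B4Strip.shiftr n k (sOf M q) ν)) ^ 2 := by
  rw [Xs, Complex.re_sum]
  refine Finset.sum_congr rfl fun k _ => ?_
  rw [lsym_pOf, ← Complex.ofReal_pow, ← Complex.ofReal_div, Complex.ofReal_re, uSym, norm_prod, ← Finset.prod_pow]
  simp_rw [norm_sq_vSym_eq_factor_sq n M c₀ hc₀ k q]
  unfold B4Strip.DeltaXir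
  rw [add_zero]

omit hM in
/-- ★ **Re-indexing the signed representatives, general data** (g0′'s `sum_reindex` for arbitrary `2πn`-periodic numerator and denominator data): for
`s_κ ∈ [−π,π]` put `θ_κ := s_κ` if `s_κ > 0` and `θ_κ := s_κ + 2π` otherwise; then
`Σ_{a∈[0,n)^J} (Π_κ F_κ(s_κ+2πa_κ))∕(Σ_κ G_κ(s_κ+2πa_κ))² = Σ_{m} (Π_κ F_κ(θ_κ+2πm_κ))∕(Σ_κ G_κ(θ_κ+2πm_κ))²`. [folklore] -/
theorem sum_reindex_gen {J : Type*} [Fintype J] [DecidableEq J] (hn : 0 < n) (s : J → ℝ) (F G : J → ℝ → ℝ)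
    (hF : ∀ κ x, F κ (x + 2 * Real.pi * n) = F κ x) (hG : ∀ κ x, G κ (x + 2 * Real.pi * n) = G κ x) :
    ∑ a : J → Fin n, (∏ κ, F κ (s κ + 2 * Real.pi * (a κ : ℕ))) / (∑ κ, G κ (s κ + 2 * Real.pi * (a κ : ℕ))) ^ 2
      = ∑ m : J → Fin n, (∏ κ, F κ ((if 0 < s κ then s κ else s κ + 2 * Real.pi) + 2 * Real.pi * (m κ : ℕ))) /
          (∑ κ, G κ ((if 0 < s κ then s κ else s κ + 2 * Real.pi) + 2 * Real.pi * (m κ : ℕ))) ^ 2 := by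
  obtain ⟨n', rfl⟩ : ∃ n', n = n' + 1 := ⟨n - 1, by omega⟩
  let ρ : (J → Fin (n' + 1)) ≃ (J → Fin (n' + 1)) :=
    Equiv.piCongrRight fun κ => if 0 < s κ then Equiv.refl _ else finRotate (n' + 1)
  rw [← ρ.sum_comp]
  refine Finset.sum_congr rfl fun m _ => ?_
  have key : ∀ κ, ∃ ε : ℕ, (ε = 0 ∨ ε = 1) ∧
      (s κ + 2 * Real.pi * ((ρ m κ : Fin (n' + 1)) : ℕ)) + 2 * Real.pi * (n' + 1 : ℕ) * ε
        = (if 0 < s κ then s κ else s κ + 2 * Real.pi) + 2 * Real.pi * (m κ : ℕ) := by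
    intro κ
    by_cases hκ : 0 < s κ
    · refine ⟨0, Or.inl rfl, ?_⟩
      simp [ρ, hκ]
    · simp only [ρ, Equiv.piCongrRight_apply, Pi.map_apply, if_neg hκ, finRotate_apply, Fin.val_add_one]
      by_cases hlast : m κ = Fin.last n'
      · refine ⟨1, Or.inr rfl, ?_⟩
        rw [if_pos hlast, hlast, Fin.val_last]
        push_cast
        ring
      · refine ⟨0, Or.inl rfl, ?_⟩
        rw [if_neg hlast]
        push_cast
        ring
  have hper : ∀ κ,
      F κ (s κ + 2 * Real.pi * ((ρ m κ : Fin (n' + 1)) : ℕ))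
        = F κ ((if 0 < s κ then s κ else s κ + 2 * Real.pi) + 2 * Real.pi * (m κ : ℕ)) ∧
      G κ (s κ + 2 * Real.pi * ((ρ m κ : Fin (n' + 1)) : ℕ))
        = G κ ((if 0 < s κ then s κ else s κ + 2 * Real.pi) + 2 * Real.pi * (m κ : ℕ)) := by
    intro κ
    obtain ⟨ε, hε, h⟩ := key κ
    rcases hε with rfl | rfl
    · simp only [Nat.cast_zero, mul_zero, add_zero] at h
      rw [h]
      exact ⟨rfl, rfl⟩
    · rw [← h, Nat.cast_one, mul_one, hF, hG]
      exact ⟨rfl, rfl⟩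
  congr 1
  · exact Finset.prod_congr rfl fun κ _ => (hper κ).1
  · congr 1
    exact Finset.sum_congr rfl fun κ _ => (hper κ).2

/-- The representatives `θ_κ` of the non-zero coordinates of `p′` lie in `(0, 2π)`. [folklore] -/
theorem theta_mem_Ioo (q : Tor M) (κ : {ν // q ν ≠ 0}) :
    0 < (if 0 < sOf M q κ.1 then sOf M q κ.1 else sOf M q κ.1 + 2 * Real.pi) ∧
      (if 0 < sOf M q κ.1 then sOf M q κ.1 else sOf M q κ.1 + 2 * Real.pi) < 2 * Real.pi := by
  have h1 := abs_le.mp (abs_sOf_le M q κ.1)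
  have h2 : sOf M q κ.1 ≠ 0 := fun h => κ.2 ((sOf_apply_eq_zero_iff M q κ.1).mp h)
  have hπ := Real.pi_pos
  by_cases h : 0 < sOf M q κ.1
  · rw [if_pos h]; constructor <;> linarith
  · rw [if_neg h]
    have h' : sOf M q κ.1 < 0 := lt_of_le_of_ne (not_lt.mp h) h2
    constructor <;> linarith

/-- ★★ **The matched symbol as a real alias sum over the support of `p′`, angles in `(0,2π)`**:
`Re Xs(p′) = Σ_{m∈[0,n)^J} (Π_κ f(θ_κ,m_κ)²)∕(Σ_κ Sxir n (θ_κ+2πm_κ))²`, `f(θ,m) = sin((θ+2πm)∕2)∕(n·sin((θ+2πm)∕(2n)))`.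
[cite: Balaban1984PropagatorsI, (1.31)–(1.33) p.23] -/
theorem matchedSymbol_re_eq_display (c₀ : ℕ) (hc₀ : 2 * c₀ + 1 = n) (q : Tor M) :
    (Xs n M (n : ℂ) q).re
      = ∑ m : {ν // q ν ≠ 0} → Fin n,
          (∏ κ, (Real.sin (((if 0 < sOf M q κ.1 then sOf M q κ.1 else sOf M q κ.1 + 2 * Real.pi)
              + 2 * Real.pi * (m κ : ℕ)) / 2) /
            ((n : ℝ) * Real.sin (((if 0 < sOf M q κ.1 then sOf M q κ.1 else sOf M q κ.1 + 2 * Real.pi)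
              + 2 * Real.pi * (m κ : ℕ)) / (2 * n)))) ^ 2) /
          (∑ κ, B4Strip.Sxir n ((if 0 < sOf M q κ.1 then sOf M q κ.1 else sOf M q κ.1 + 2 * Real.pi)
              + 2 * Real.pi * (m κ : ℕ))) ^ 2 := by
  classical
  rw [Xs_re_eq_realSum n M c₀ hc₀ q]
  have hshift : ∀ (k : Fin d → Fin n) ν, B4Strip.shiftr n k (sOf M q) ν = sOf M q ν + 2 * Real.pi * ((k ν : ℕ) : ℝ) :=
    fun k ν => rfl
  simp_rw [hshift]
  rw [sum_collapse (fun ν => q ν ≠ 0)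
    (fun ν m => (if q ν = 0 then (if m = 0 then (1 : ℝ) else 0) else
      Real.sin ((sOf M q ν + 2 * Real.pi * ((m : ℕ) : ℝ)) / 2) /
        ((n : ℝ) * Real.sin ((sOf M q ν + 2 * Real.pi * ((m : ℕ) : ℝ)) / (2 * n)))) ^ 2)
    (fun ν m => B4Strip.Sxir n (sOf M q ν + 2 * Real.pi * ((m : ℕ) : ℝ)))]
  rotate_left
  · intro ν hν
    rw [not_not] at hν
    simp [hν]
  · intro ν m hν hm
    rw [not_not] at hν
    simp [hν, hm]
  · intro ν hν
    rw [not_not] at hν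
    rw [(sOf_apply_eq_zero_iff M q ν).mpr hν]
    simp [B4Strip.Sxir]
  have hodd : Odd n := ⟨c₀, by omega⟩
  have hres : ∀ (a : {ν // q ν ≠ 0} → Fin n) (κ : {ν // q ν ≠ 0}),
      (if q κ.1 = 0 then (if a κ = 0 then (1 : ℝ) else 0) else
        Real.sin ((sOf M q κ.1 + 2 * Real.pi * ((a κ : ℕ) : ℝ)) / 2) /
          ((n : ℝ) * Real.sin ((sOf M q κ.1 + 2 * Real.pi * ((a κ : ℕ) : ℝ)) / (2 * n)))) ^ 2
      = (fun (κ : {ν // q ν ≠ 0}) (x : ℝ) => (Real.sin (x / 2) / ((n : ℝ) * Real.sin (x / (2 * n)))) ^ 2) κ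
          (sOf M q κ.1 + 2 * Real.pi * ((a κ : ℕ) : ℝ)) := by
    intro a κ
    rw [if_neg κ.2]
  simp_rw [hres]
  rw [sum_reindex_gen n hodd.pos (fun κ : {ν // q ν ≠ 0} => sOf M q κ.1)
    (fun _ x => (Real.sin (x / 2) / ((n : ℝ) * Real.sin (x / (2 * n)))) ^ 2) (fun _ x => B4Strip.Sxir n x)
    (fun κ x => by simp only [phi1_periodic hodd]) (fun κ x => phi2_periodic hodd.pos.ne' x)]

/-- ★★ **The centre symbol as a real alias sum over the support of `p′`, angles in `(0,2π)`** (the equation behind g0′'s `centreSymbol_ne_zero`):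
`Re K_{c₀}(p′) = Σ_{m∈[0,n)^J} (Π_κ f(θ_κ,m_κ))∕(Σ_κ Sxir n (θ_κ+2πm_κ))²`. [cite: Balaban1984PropagatorsI, (1.31) p.23; Balaban1987RG1, (0.4) p.253] -/
theorem centreSymbol_re_eq_display (c₀ : Fin d → Fin n) (hc₀ : ∀ ν, 2 * (c₀ ν : ℕ) + 1 = n) {q : Tor M} (hq : q ≠ 0) :
    (∑ k : Fin d → Fin n, chi (fine n M) (pOf n M (k, q)) (iota n M c₀) * conj (uSym n k (sOf M q)) /
        lsym (fine n M) (n : ℂ) (pOf n M (k, q)) ^ 2).re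
      = ∑ m : {ν // q ν ≠ 0} → Fin n,
          (∏ κ, Real.sin (((if 0 < sOf M q κ.1 then sOf M q κ.1 else sOf M q κ.1 + 2 * Real.pi)
              + 2 * Real.pi * (m κ : ℕ)) / 2) /
            ((n : ℝ) * Real.sin (((if 0 < sOf M q κ.1 then sOf M q κ.1 else sOf M q κ.1 + 2 * Real.pi)
              + 2 * Real.pi * (m κ : ℕ)) / (2 * n)))) /
          (∑ κ, B4Strip.Sxir n ((if 0 < sOf M q κ.1 then sOf M q κ.1 else sOf M q κ.1 + 2 * Real.pi)
              + 2 * Real.pi * (m κ : ℕ))) ^ 2 := by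
  classical
  simp_rw [summand_eq_real n M c₀ hc₀ q]
  rw [← Complex.ofReal_sum, Complex.ofReal_re]
  have hshift : ∀ (k : Fin d → Fin n) ν, B4Strip.shiftr n k (sOf M q) ν = sOf M q ν + 2 * Real.pi * ((k ν : ℕ) : ℝ) :=
    fun k ν => rfl
  simp_rw [hshift]
  rw [sum_collapse (fun ν => q ν ≠ 0)
    (fun ν m => if q ν = 0 then (if m = 0 then (1 : ℝ) else 0) else
      Real.sin ((sOf M q ν + 2 * Real.pi * ((m : ℕ) : ℝ)) / 2) /
        ((n : ℝ) * Real.sin ((sOf M q ν + 2 * Real.pi * ((m : ℕ) : ℝ)) / (2 * n))))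
    (fun ν m => B4Strip.Sxir n (sOf M q ν + 2 * Real.pi * ((m : ℕ) : ℝ)))]
  rotate_left
  · intro ν hν
    rw [not_not] at hν
    simp [hν]
  · intro ν m hν hm
    rw [not_not] at hν
    simp [hν, hm]
  · intro ν hν
    rw [not_not] at hν
    rw [(sOf_apply_eq_zero_iff M q ν).mpr hν]
    simp [B4Strip.Sxir]
  have hne : Nonempty {ν // q ν ≠ 0} := by
    obtain ⟨ν, hν⟩ := Function.ne_iff.mp hq
    exact ⟨⟨ν, hν⟩⟩
  have hodd : Odd n := ⟨c₀ (Classical.choice hne).1, by have := hc₀ (Classical.choice hne).1; omega⟩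
  have hres : ∀ (a : {ν // q ν ≠ 0} → Fin n) (κ : {ν // q ν ≠ 0}),
      (if q κ.1 = 0 then (if a κ = 0 then (1 : ℝ) else 0) else
        Real.sin ((sOf M q κ.1 + 2 * Real.pi * ((a κ : ℕ) : ℝ)) / 2) /
          ((n : ℝ) * Real.sin ((sOf M q κ.1 + 2 * Real.pi * ((a κ : ℕ) : ℝ)) / (2 * n))))
      = Real.sin ((sOf M q κ.1 + 2 * Real.pi * ((a κ : ℕ) : ℝ)) / 2) /
          ((n : ℝ) * Real.sin ((sOf M q κ.1 + 2 * Real.pi * ((a κ : ℕ) : ℝ)) / (2 * n))) := by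
    intro a κ
    rw [if_neg κ.2]
  simp_rw [hres]
  exact sum_reindex hodd _

end Display

/-! ## §9  «display margin ⇒ symbol margin» -/

section Margin

variable {d : ℕ} (n : ℕ) [NeZero n] (M : Fin d → ℕ) [hM : ∀ μ, NeZero (M μ)]

/-- ★★★ **DISPLAY MARGIN ⇒ SYMBOL MARGIN.**  Suppose the bare alias sums admit a PER-COORDINATE domination constant `c₁ ∈ [0,1]`: for every finite
non-empty index type `J` and every `θ ∈ (0,2π)^J`,
`c₁^{|J|} · Σ_{m∈[0,n)^J} (Π_κ f(θ_κ,m_κ)²)∕(Σ_κ S(θ_κ,m_κ))² ≤ Σ_m (Π_κ f(θ_κ,m_κ))∕(Σ_κ S(θ_κ,m_κ))²`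
(`f(θ,m) = sin((θ+2πm)∕2)∕(n·sin((θ+2πm)∕(2n)))`, `S(θ,m) = Sxir n (θ+2πm)`; dag-n07-w7 g4's piece, announced with `c₁ = 1∕π`; numerically `c₁ = 1`).
Then at every non-zero coarse momentum of a `d`-dimensional torus `c₁^d · Re Xs(p′) ≤ Re K_{c₀}(p′)` — the hypothesis `hK` of
`…OneLevelForms.matchedForm_le_centreForm_of_symbol` with `cst = c₁^d` (odd `n = 2c₀+1`, B5's lattice constant `c = n`; `|supp p′| ≤ d`).
[cite: Balaban1984PropagatorsI, (1.31)–(1.33) p.23; Balaban1987RG1, (0.4) p.253] -/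
theorem symbolMargin_of_display (c₀ : Fin d → Fin n) (hc₀ : ∀ ν, 2 * (c₀ ν : ℕ) + 1 = n) {c₁ : ℝ} (hc₁ : 0 ≤ c₁) (hc₁' : c₁ ≤ 1)
    (hDisp : ∀ (J : Type) [Fintype J] [DecidableEq J] [Nonempty J] (θ : J → ℝ),
      (∀ κ, 0 < θ κ ∧ θ κ < 2 * Real.pi) →
      c₁ ^ Fintype.card J * ∑ m : J → Fin n, (∏ κ, (Real.sin ((θ κ + 2 * Real.pi * (m κ : ℕ)) / 2) /
          ((n : ℝ) * Real.sin ((θ κ + 2 * Real.pi * (m κ : ℕ)) / (2 * n)))) ^ 2) /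
          (∑ κ, B4Strip.Sxir n (θ κ + 2 * Real.pi * (m κ : ℕ))) ^ 2
        ≤ ∑ m : J → Fin n, (∏ κ, Real.sin ((θ κ + 2 * Real.pi * (m κ : ℕ)) / 2) /
          ((n : ℝ) * Real.sin ((θ κ + 2 * Real.pi * (m κ : ℕ)) / (2 * n)))) /
          (∑ κ, B4Strip.Sxir n (θ κ + 2 * Real.pi * (m κ : ℕ))) ^ 2)
    {q : Tor M} (hq : q ≠ 0) :
    c₁ ^ d * (Xs n M (n : ℂ) q).re ≤
      (∑ k : Fin d → Fin n, chi (fine n M) (pOf n M (k, q)) (iota n M c₀) * conj (uSym n k (sOf M q)) /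
        lsym (fine n M) (n : ℂ) (pOf n M (k, q)) ^ 2).re := by
  classical
  have hne : Nonempty {ν // q ν ≠ 0} := by
    obtain ⟨ν, hν⟩ := Function.ne_iff.mp hq
    exact ⟨⟨ν, hν⟩⟩
  rw [matchedSymbol_re_eq_display n M (c₀ (Classical.choice hne).1) (hc₀ _) q,
    centreSymbol_re_eq_display n M c₀ hc₀ hq]
  have h := hDisp {ν // q ν ≠ 0} _ (theta_mem_Ioo M q)
  refine le_trans ?_ h
  refine mul_le_mul_of_nonneg_right ?_
    (Finset.sum_nonneg fun _ _ => div_nonneg (Finset.prod_nonneg fun _ _ => sq_nonneg _) (sq_nonneg _))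
  have hcard : Fintype.card {ν // q ν ≠ 0} ≤ d := (Fintype.card_subtype_le _).trans (Fintype.card_fin d).le
  exact pow_le_pow_of_le_one hc₁ hc₁' hcard

omit [NeZero n] hM in
/-- The display margin holds with `c₁ = 0` (g0′'s ∕ dag-n07-w7's positivity `signed_alias_sum_pos` = `aliasSymbolK_pos`): the hypothesis of
`symbolMargin_of_display` is inhabited. [cite: Balaban1987RG1, (0.4) p.253] -/
theorem displayMargin_zero (hn : Odd n) (J : Type) [Fintype J] [DecidableEq J] [Nonempty J] (θ : J → ℝ)
    (hθ : ∀ κ, 0 < θ κ ∧ θ κ < 2 * Real.pi) :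
    (0 : ℝ) ^ Fintype.card J * ∑ m : J → Fin n, (∏ κ, (Real.sin ((θ κ + 2 * Real.pi * (m κ : ℕ)) / 2) /
          ((n : ℝ) * Real.sin ((θ κ + 2 * Real.pi * (m κ : ℕ)) / (2 * n)))) ^ 2) /
          (∑ κ, B4Strip.Sxir n (θ κ + 2 * Real.pi * (m κ : ℕ))) ^ 2
      ≤ ∑ m : J → Fin n, (∏ κ, Real.sin ((θ κ + 2 * Real.pi * (m κ : ℕ)) / 2) /
          ((n : ℝ) * Real.sin ((θ κ + 2 * Real.pi * (m κ : ℕ)) / (2 * n)))) /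
          (∑ κ, B4Strip.Sxir n (θ κ + 2 * Real.pi * (m κ : ℕ))) ^ 2 := by
  rw [zero_pow Fintype.card_ne_zero, zero_mul]
  have hπ := Real.pi_pos
  -- bring `θ` to signed representatives in `[−π, π] ∖ {0}` and use `signed_alias_sum_pos` (whose re-indexing returns `θ`)
  let s : J → ℝ := fun κ => if θ κ ≤ Real.pi then θ κ else θ κ - 2 * Real.pi
  have hs : ∀ κ, |s κ| ≤ Real.pi := by
    intro κ
    have h := hθ κ
    simp only [s]
    split_ifs with h1
    · rw [abs_le]; constructor <;> linarith
    · rw [abs_le]; push Not at h1; constructor <;> linarith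
  have hs0 : ∀ κ, s κ ≠ 0 := by
    intro κ
    have h := hθ κ
    simp only [s]
    split_ifs with h1
    · exact h.1.ne'
    · push Not at h1; intro h0; linarith
  have hback : ∀ κ, (if 0 < s κ then s κ else s κ + 2 * Real.pi) = θ κ := by
    intro κ
    have h := hθ κ
    simp only [s]
    split_ifs with h1 h2 h2
    · rfl
    · exact absurd h.1 h2
    · push Not at h1; exfalso; linarith
    · ring
  have hpos := signed_alias_sum_pos hn s hs hs0
  rw [sum_reindex hn s] at hpos
  simp_rw [hback] at hpos
  exact hpos.le

/-- ★★★ **THE ONE-LEVEL MARGIN IN x-SPACE FROM A DISPLAY MARGIN** (this file ∘ `…OneLevelForms.norm_sq_lapInv_le_centreForm_of_symbol`): under the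
display margin with per-coordinate constant `c₁ ∈ [0,1]`, for EVERY block function `β` on the coarse torus of a `d`-dimensional lattice,
`c₁^d · ‖Δ⁻¹Q′ᴴβ‖² ≤ Re Σ_y conj β(y) · (Δ⁻²Q′ᴴβ)(ny + c₀)` — the located note's (★)₁ «`c·‖Δw_β‖² ≤ Σ_B β_B |B| w_β(c_B)`» at one level, odd
`n = 2c₀+1`, every torus, with `c = c₁^d` INDEPENDENT of the torus. [cite: Balaban1984PropagatorsI, Sect. C p.22, (1.30)–(1.33) p.23;
Balaban1987RG1, (0.4) p.253] -/
theorem norm_sq_lapInv_le_centreForm_of_display (c₀ : Fin d → Fin n) (hc₀ : ∀ ν, 2 * (c₀ ν : ℕ) + 1 = n) {c₁ : ℝ}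
    (hc₁ : 0 ≤ c₁) (hc₁' : c₁ ≤ 1)
    (hDisp : ∀ (J : Type) [Fintype J] [DecidableEq J] [Nonempty J] (θ : J → ℝ),
      (∀ κ, 0 < θ κ ∧ θ κ < 2 * Real.pi) →
      c₁ ^ Fintype.card J * ∑ m : J → Fin n, (∏ κ, (Real.sin ((θ κ + 2 * Real.pi * (m κ : ℕ)) / 2) /
          ((n : ℝ) * Real.sin ((θ κ + 2 * Real.pi * (m κ : ℕ)) / (2 * n)))) ^ 2) /
          (∑ κ, B4Strip.Sxir n (θ κ + 2 * Real.pi * (m κ : ℕ))) ^ 2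
        ≤ ∑ m : J → Fin n, (∏ κ, Real.sin ((θ κ + 2 * Real.pi * (m κ : ℕ)) / 2) /
          ((n : ℝ) * Real.sin ((θ κ + 2 * Real.pi * (m κ : ℕ)) / (2 * n)))) /
          (∑ κ, B4Strip.Sxir n (θ κ + 2 * Real.pi * (m κ : ℕ))) ^ 2)
    (β : Tor M → ℂ) :
    c₁ ^ d * ∑ x, ‖(LapSinv (fine n M) (n : ℂ) *ᵥ ((QsOp n M)ᴴ *ᵥ β)) x‖ ^ 2 ≤
      (star β ⬝ᵥ (fun y => (LapSinv (fine n M) (n : ℂ) *ᵥ (LapSinv (fine n M) (n : ℂ) *ᵥ ((QsOp n M)ᴴ *ᵥ β)))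
        (bpt n M y c₀))).re :=
  norm_sq_lapInv_le_centreForm_of_symbol n M (n : ℂ) c₀ (c₁ ^ d)
    (fun _ hq => symbolMargin_of_display n M c₀ hc₀ hc₁ hc₁' hDisp hq) β

end Margin

end Summit.QuantumFields.YangMills.BalabanUVNodes.N07PointFeasibilityOneLevel

end
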